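import Literature.NumberTheory.EllipticCurves.SelmerCorankControlProofs
import Literature.NumberTheory.EllipticCurves.IwasawaAlgebraStructureProofs
import HarnessLib

/-!
# `ord_T f_X = rank_{ℤ_p} X[T^n]` for a finitely generated torsion `Λ`-module (proofs)

Sibling proof file (theorems only; D-0014) of `Literature.NumberTheory.EllipticCurves.SelmerCorankControl`
/ `SelmerCorankControlProofs`, in the generic commutative algebra of the Iwasawa algebra
`Λ = ℤ_p⟦T⟧ = IwasawaAlgebra p`. For a finitely generated torsion `Λ`-module `X` with
characteristic ideal `(f)` (`Literature.NumberTheory.EllipticCurves.Module.charIdeal`, Bourbaki's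
`∏_{ht 𝔮 = 1} 𝔮^{ℓ_𝔮(X)}`), the power of `T` dividing `f` is computed by the `T`-power torsion of
`X` itself:

* `IwasawaAlgebra.lengthAt_eq_toENat_rank_of_X_pow_smul_eq_zero` : if `T^n N = 0` then
  `ℓ_{(T)}(N) = rank_{ℤ_p} N` (induction on `n` from the case `n = 1` of
  `SelmerCorankControlProofs`, `0 → N[T] → N → N/N[T] → 0`, additivity of local lengths and of
  `ℤ_p`-ranks);
* `IwasawaAlgebra.lengthAt_eq_toENat_rank_torsionBy` : if `a X = 0` with `a = T^N b ≠ 0`,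
  `b(0) ≠ 0`, then `ℓ_{(T)}(X) = rank_{ℤ_p} X[T^n]` for every `n ≥ N` (`b ∉ (T)` kills
  `X / X[T^n]`, so `(X/X[T^n])_{(T)} = 0`);
* `IwasawaAlgebra.order_charGenerator_eq_finrank_torsionBy` : hence, for `X` finitely generated
  and torsion with `char(X) = (f)`, **`ord_T f = rank_{ℤ_p} X[T^n]`** for all large `n`
  (`ord_T f = ℓ_{(T)}(X)` is `IwasawaAlgebra.order_eq_toNat_lengthAt`), with the existence form
  `IwasawaAlgebra.exists_order_charGenerator_eq_finrank_torsionBy`;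
* `IwasawaAlgebra.finite_baseChange_of_isTorsion` : `V = ℚ_p ⊗_{ℤ_p} X` is finite-dimensional
  (structure theorem `exists_isPseudoIsomorphism_elementary_holds` and flat base change, exactly as
  in the tree proof of `lambdaInvariant_eq_sum_natDegree`), and conversely
  `IwasawaAlgebra.isTorsion_of_finite_baseChange` : any `Λ`-module structure on a `ℤ_p`-module `X`
  with `dim_{ℚ_p} ℚ_p ⊗ X < ∞` is `Λ`-torsion (`x, Tx, …, T^d x` are dependent in `V`).

These are the two module-theoretic invariants — `rank_{ℤ_p} X[T^n]` and `dim_{ℚ_p} ℚ_p ⊗ X` —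
through which `ord_T f_E` and the cotorsion of `Sel_{p^∞}(E/K_∞)` are seen to be independent of
the choice of topological generator `γ` (`T = γ - 1`) in the companion file
`IwasawaGeneratorChangeProofs` (Greenberg, LNM 1716, §1, p. 60: the `Λ`-module structure of
`X = Hom(Sel, ℚ_p/ℤ_p)` comes from the `Γ`-action; Washington §13.2; the classical remark that
`λ`, `μ` and the characteristic ideal do not depend on the choice of `γ`).

In the language of Greenberg, §1 (after Conj. 1.12, p. 65 of the held Cetraro volume):
`X ∼ ⊕ Λ/(f_i^{a_i})`, the power of `T` dividing `f = ∏ f_i^{a_i}` is `∑_{(f_i)=(T)} a_i`, and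
`X[T^n] ⊗ ℚ_p ≅ ⊕_{(f_i) = (T)} (Λ/(T^{a_i})) ⊗ ℚ_p` for `n ≥ max a_i`, of dimension `∑ a_i`;
the proofs below avoid the structure theorem for this statement (only `finite_baseChange_of_isTorsion`
uses it) and go through local lengths at `𝔭 = (T)` (Bourbaki AC VII §4.4; Washington §13.2).

## References

* R. Greenberg, *Iwasawa theory for elliptic curves*, LNM 1716 (1999), §1 (held copy
  `book:coatesnd-arithmetic-theory-elliptic-curves`, PDF p. 60 and p. 65). [GreenbergLNM1716]
* L. C. Washington, *Introduction to Cyclotomic Fields*, GTM 83, 2nd ed. (1997), §13.2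
  (Thm. 13.12, Prop. 13.8, Lemma 13.7). [Washington1997]
* N. Bourbaki, *Algèbre commutative*, Ch. VII §4.4–4.5.
-/

noncomputable section

open scoped TensorProduct nonZeroDivisors DirectSum

universe u

namespace Literature.NumberTheory.EllipticCurves

namespace IwasawaAlgebra

variable (p : ℕ) [Fact p.Prime]

/-! ### Modules killed by a power of `T` -/

section KilledByPow

variable (𝔭 : PrimeSpectrum (IwasawaAlgebra p))
  (h𝔭 : 𝔭.asIdeal = Ideal.span {(PowerSeries.X : IwasawaAlgebra p)})

include h𝔭 in
/-- **`ℓ_{(T)}(N) = rank_{ℤ_p} N` for a `Λ`-module `N` killed by `T^n`** (in `ℕ∞`, for the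
compatible `ℤ_p`-structure): induction on `n`, the case `n = 1` being
`lengthAt_eq_toENat_rank_of_X_smul_eq_zero` (`N_{(T)}` is then a vector space over the residue
field `κ((T)) = Frac ℤ_p`), via `0 → N[T] → N → N/N[T] → 0` with `T^{n} (N/N[T]) = 0`, the
additivity of local lengths (`Module.lengthAt_eq_add_of_exact`) and of `ℤ_p`-ranks
(`Submodule.rank_quotient_add_rank`). Washington §13.2 (`Λ/(T^n) ≅ ℤ_p^n`, Prop. 13.8);
Bourbaki AC VII §4.4. [folklore] -/
theorem lengthAt_eq_toENat_rank_of_X_pow_smul_eq_zero (n : ℕ) :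
    ∀ (N : Type u) [AddCommGroup N] [Module (IwasawaAlgebra p) N] [Module ℤ_[p] N]
      [IsScalarTower ℤ_[p] (IwasawaAlgebra p) N],
      (∀ x : N, (PowerSeries.X : IwasawaAlgebra p) ^ n • x = 0) →
        Module.lengthAt (IwasawaAlgebra p) N 𝔭 = Cardinal.toENat (Module.rank ℤ_[p] N) := by
  induction n with
  | zero =>
    intro N _ _ _ _ hT
    haveI : Subsingleton N := ⟨fun x y ↦ by
      have hx := hT x
      have hy := hT y
      rw [pow_zero, one_smul] at hx hy
      rw [hx, hy]⟩
    rw [Module.lengthAt_eq_zero_of_subsingleton, rank_subsingleton', map_zero]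
  | succ n ih =>
    intro N _ _ _ _ hT
    -- `N₁ = N[T]`, killed by `T`; `N / N₁` is killed by `T^n`
    let N₁ : Submodule (IwasawaAlgebra p) N :=
      Submodule.torsionBy (IwasawaAlgebra p) N (PowerSeries.X : IwasawaAlgebra p)
    have hN₁ : ∀ x : N₁, (PowerSeries.X : IwasawaAlgebra p) • x = 0 := fun x ↦
      Subtype.ext ((Submodule.mem_torsionBy_iff _ _).mp x.2)
    have h1 : Module.lengthAt (IwasawaAlgebra p) N₁ 𝔭 = Cardinal.toENat (Module.rank ℤ_[p] N₁) :=
      lengthAt_eq_toENat_rank_of_X_smul_eq_zero p hN₁ 𝔭 h𝔭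
    have h2 : Module.lengthAt (IwasawaAlgebra p) (N ⧸ N₁) 𝔭 =
        Cardinal.toENat (Module.rank ℤ_[p] (N ⧸ N₁)) := by
      refine ih (N ⧸ N₁) fun q ↦ ?_
      induction q using Submodule.Quotient.induction_on with
      | H x =>
        rw [← Submodule.Quotient.mk_smul, Submodule.Quotient.mk_eq_zero, Submodule.mem_torsionBy_iff,
          smul_smul, ← pow_succ']
        exact hT x
    rw [Module.lengthAt_eq_add_of_exact _ _ (Submodule.subtype_injective N₁)
        (Submodule.mkQ_surjective N₁) (LinearMap.exact_subtype_mkQ N₁) 𝔭, h1, h2,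
      ← Submodule.rank_quotient_add_rank (N₁.restrictScalars ℤ_[p]), map_add, add_comm,
      (Submodule.Quotient.restrictScalarsEquiv ℤ_[p] N₁).rank_eq]
    rfl

end KilledByPow

/-! ### `ℓ_{(T)}(X) = rank_{ℤ_p} X[T^n]` and `ord_T f = rank_{ℤ_p} X[T^n]` -/

section TorsionBy

variable {M : Type u} [AddCommGroup M] [Module (IwasawaAlgebra p) M] [Module ℤ_[p] M]
  [IsScalarTower ℤ_[p] (IwasawaAlgebra p) M]

/-- **`ℓ_{(T)}(X) = rank_{ℤ_p} X[T^n]`.** If the `Λ`-module `X` is killed by some `a ≠ 0`, written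
`a = T^N b` with `b(0) ≠ 0` (`N = ord_T a`, `b = PowerSeries.divXPowOrder a`), then for every
`n ≥ N` the local length of `X` at `(T)` is the `ℤ_p`-rank of the `T^n`-torsion `X[T^n]`
(`Submodule.torsionBy`): `b ∉ (T)` kills `X/X[T^n]` (for `T^n b x = T^{n-N} a x = 0`), so
`(X/X[T^n])_{(T)} = 0` and `ℓ_{(T)}(X) = ℓ_{(T)}(X[T^n]) = rank_{ℤ_p} X[T^n]`
(`lengthAt_eq_toENat_rank_of_X_pow_smul_eq_zero`). Washington §13.2; Bourbaki AC VII §4.4.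
[folklore] -/
theorem lengthAt_eq_toENat_rank_torsionBy {a : IwasawaAlgebra p} (ha0 : a ≠ 0)
    (ha : ∀ x : M, a • x = 0) {n : ℕ} (hn : a.order.toNat ≤ n)
    (𝔭 : PrimeSpectrum (IwasawaAlgebra p))
    (h𝔭 : 𝔭.asIdeal = Ideal.span {(PowerSeries.X : IwasawaAlgebra p)}) :
    Module.lengthAt (IwasawaAlgebra p) M 𝔭 =
      Cardinal.toENat (Module.rank ℤ_[p]
        (Submodule.torsionBy (IwasawaAlgebra p) M ((PowerSeries.X : IwasawaAlgebra p) ^ n))) := by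
  let N₁ : Submodule (IwasawaAlgebra p) M :=
    Submodule.torsionBy (IwasawaAlgebra p) M ((PowerSeries.X : IwasawaAlgebra p) ^ n)
  have hb : PowerSeries.constantCoeff (PowerSeries.divXPowOrder a) ≠ 0 := by
    rw [Ne, PowerSeries.constantCoeff_divXPowOrder_eq_zero_iff]
    exact ha0
  obtain ⟨k, hk⟩ := Nat.exists_eq_add_of_le hn
  -- `(X / X[T^n])_{(T)} = 0`
  have h0 : Module.lengthAt (IwasawaAlgebra p) (M ⧸ N₁) 𝔭 = 0 := by
    rw [Module.lengthAt_eq_zero_iff, LocalizedModule.subsingleton_iff]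
    intro q
    induction q using Submodule.Quotient.induction_on with
    | H x =>
      refine ⟨PowerSeries.divXPowOrder a, ?_, ?_⟩
      · rw [Ideal.mem_primeCompl_iff, h𝔭, mem_span_X_iff]
        exact hb
      · rw [← Submodule.Quotient.mk_smul, Submodule.Quotient.mk_eq_zero, Submodule.mem_torsionBy_iff,
          smul_smul, hk, pow_add, mul_right_comm, PowerSeries.X_pow_order_mul_divXPowOrder,
          mul_smul, ha]
  -- `X[T^n]` is killed by `T^n`
  have hN₁ : ∀ x : N₁, (PowerSeries.X : IwasawaAlgebra p) ^ n • x = 0 := fun x ↦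
    Subtype.ext ((Submodule.mem_torsionBy_iff _ _).mp x.2)
  rw [Module.lengthAt_eq_add_of_exact _ _ (Submodule.subtype_injective N₁)
      (Submodule.mkQ_surjective N₁) (LinearMap.exact_subtype_mkQ N₁) 𝔭, h0, add_zero]
  exact lengthAt_eq_toENat_rank_of_X_pow_smul_eq_zero p 𝔭 h𝔭 n N₁ hN₁

/-- **`ord_T f = rank_{ℤ_p} X[T^n]`.** For a finitely generated torsion `Λ`-module `X` with
`char(X) = (f)`, killed by `a ≠ 0`, and every `n ≥ ord_T a`: the power of `T` dividing `f`
(`PowerSeries.order f`) is the `ℤ_p`-rank (`Module.finrank`) of the `T^n`-torsion submodule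
`X[T^n]` — `ord_T f = ℓ_{(T)}(X)` (`order_eq_toNat_lengthAt`) `= rank_{ℤ_p} X[T^n]`
(`lengthAt_eq_toENat_rank_torsionBy`). In the notation of the structure theorem
`X ∼ ⊕ Λ/(f_i^{a_i})` both sides equal `∑_{(f_i) = (T)} a_i` (Washington, Thm. 13.12 and
Prop. 13.8; Greenberg, LNM 1716, §1 p. 65: "the power of `T` dividing `f_E(T)`").
[cite: Washington1997, §13.2 (Thm. 13.12, Prop. 13.8)] -/
theorem order_charGenerator_eq_finrank_torsionBy [Module.Finite (IwasawaAlgebra p) M]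
    (hM : Module.IsTorsion (IwasawaAlgebra p) M) (f : IwasawaAlgebra p)
    (hf : Module.charIdeal (IwasawaAlgebra p) M = Ideal.span {f})
    {a : IwasawaAlgebra p} (ha0 : a ≠ 0) (ha : ∀ x : M, a • x = 0) {n : ℕ}
    (hn : a.order.toNat ≤ n) :
    f.order = (Module.finrank ℤ_[p]
      (Submodule.torsionBy (IwasawaAlgebra p) M ((PowerSeries.X : IwasawaAlgebra p) ^ n)) : ℕ∞) := by
  obtain ⟨𝔭, h𝔭⟩ : ∃ 𝔭 : PrimeSpectrum (IwasawaAlgebra p),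
      𝔭.asIdeal = Ideal.span {(PowerSeries.X : IwasawaAlgebra p)} :=
    ⟨⟨_, (Ideal.span_singleton_prime PowerSeries.X_ne_zero).mpr PowerSeries.X_prime⟩, rfl⟩
  rw [order_eq_toNat_lengthAt p hM f hf 𝔭 h𝔭, lengthAt_eq_toENat_rank_torsionBy p ha0 ha hn 𝔭 h𝔭,
    Cardinal.toNat_toENat]
  rfl

/-- **`ord_T f = rank_{ℤ_p} X[T^n]` for all large `n`** (existence form of
`order_charGenerator_eq_finrank_torsionBy`: a finitely generated torsion module over the domain
`Λ` is killed by a non-zero-divisor, `Submodule.annihilator_top_inter_nonZeroDivisors`).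
[cite: Washington1997, §13.2 (Thm. 13.12, Prop. 13.8)] -/
theorem exists_order_charGenerator_eq_finrank_torsionBy [Module.Finite (IwasawaAlgebra p) M]
    (hM : Module.IsTorsion (IwasawaAlgebra p) M) (f : IwasawaAlgebra p)
    (hf : Module.charIdeal (IwasawaAlgebra p) M = Ideal.span {f}) :
    ∃ n₀ : ℕ, ∀ n, n₀ ≤ n → f.order = (Module.finrank ℤ_[p]
      (Submodule.torsionBy (IwasawaAlgebra p) M ((PowerSeries.X : IwasawaAlgebra p) ^ n)) : ℕ∞) := by
  obtain ⟨a, ha, ha0⟩ := Submodule.annihilator_top_inter_nonZeroDivisors hM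
  have haM : ∀ x : M, a • x = 0 := fun x ↦ Submodule.mem_annihilator.mp ha x Submodule.mem_top
  exact ⟨a.order.toNat, fun n hn ↦
    order_charGenerator_eq_finrank_torsionBy p hM f hf (nonZeroDivisors.ne_zero ha0) haM hn⟩

end TorsionBy

/-! ### `ℚ_p ⊗_{ℤ_p} X` is finite-dimensional iff `X` is `Λ`-torsion (for `X` finitely generated) -/

section BaseChange

variable {M : Type u} [AddCommGroup M] [Module (IwasawaAlgebra p) M] [Module ℤ_[p] M]
  [IsScalarTower ℤ_[p] (IwasawaAlgebra p) M]

/-- **`V = ℚ_p ⊗_{ℤ_p} X` is finite-dimensional for a finitely generated torsion `Λ`-module `X`**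
(the `λ`-invariant is an honest dimension). By the structure theorem
(`exists_isPseudoIsomorphism_elementary_holds`) there is a pseudo-isomorphism
`X → E = ⨁ Λ/(p^{μ_i}) ⊕ ⨁ Λ/(f_j^{n_j})`; its composite with the projection to
`E₂ = ⨁ Λ/(f_j^{n_j})` has `p`-power-torsion kernel and cokernel (pseudo-null `Λ`-modules are
`p`-power torsion elementwise, `exists_C_p_pow_smul_eq_zero_of_isPseudoNull`), so
`ℚ_p ⊗ X ≅ ℚ_p ⊗ E₂` (`Module.bijective_baseChange_of_pow_smul`, `ℚ_p` flat over `ℤ_p`), and `E₂`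
is free of finite rank over `ℤ_p` (`finite_quotient_pow`, Weierstrass division). Same argument as
the tree proof `lambdaInvariant_eq_sum_natDegree_holds`. Washington §13.2 (definition of `λ`
after Thm. 13.12; Prop. 13.8). [cite: Washington1997, §13.2 (Thm. 13.12, Prop. 13.8)] -/
theorem finite_baseChange_of_isTorsion [Module.Finite (IwasawaAlgebra p) M]
    (hM : Module.IsTorsion (IwasawaAlgebra p) M) :
    Module.Finite ℚ_[p] (ℚ_[p] ⊗[ℤ_[p]] M) := by
  obtain ⟨μs, fs, -, hfs, φ, hkerφ, hcokerφ⟩ := exists_isPseudoIsomorphism_elementary_holds p M hM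
  let E₁ := ⨁ i : Fin μs.length,
    IwasawaAlgebra p ⧸ Ideal.span {PowerSeries.C ((p : ℤ_[p]) ^ μs.get i)}
  let E₂ := ⨁ j : Fin fs.length,
    IwasawaAlgebra p ⧸ Ideal.span {((fs.get j).1 : IwasawaAlgebra p) ^ (fs.get j).2}
  haveI : ∀ j : Fin fs.length, Module.Free ℤ_[p]
      (IwasawaAlgebra p ⧸ Ideal.span {((fs.get j).1 : IwasawaAlgebra p) ^ (fs.get j).2}) :=
    fun j ↦ free_quotient_pow p (hfs _ (List.get_mem fs j)).1 _
  haveI : ∀ j : Fin fs.length, Module.Finite ℤ_[p]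
      (IwasawaAlgebra p ⧸ Ideal.span {((fs.get j).1 : IwasawaAlgebra p) ^ (fs.get j).2}) :=
    fun j ↦ finite_quotient_pow p (hfs _ (List.get_mem fs j)).1 _
  haveI : Module.Flat ℤ_[p] ℚ_[p] := IsLocalization.flat ℚ_[p] (nonZeroDivisors ℤ_[p])
  -- the composite `M → E → E₂`
  let φ' : M →ₗ[IwasawaAlgebra p] E₁ × E₂ := φ
  let ψ : M →ₗ[IwasawaAlgebra p] E₂ := LinearMap.snd (IwasawaAlgebra p) E₁ E₂ ∘ₗ φ'
  have hker : ∀ x : M, ψ.restrictScalars ℤ_[p] x = 0 → ∃ n : ℕ, (p : ℤ_[p]) ^ n • x = 0 := by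
    intro x hx
    have hx2 : (φ' x).2 = 0 := hx
    have hN : (PowerSeries.C (p : ℤ_[p]) : IwasawaAlgebra p) ^ μs.sum • x ∈ LinearMap.ker φ' := by
      rw [LinearMap.mem_ker, map_smul]
      ext1
      · rw [Prod.smul_fst, C_p_pow_sum_smul_eq_zero, Prod.fst_zero]
      · rw [Prod.smul_snd, hx2, smul_zero, Prod.snd_zero]
    obtain ⟨n, hn⟩ := exists_C_p_pow_smul_eq_zero_of_isPseudoNull p hkerφ ⟨_, hN⟩
    refine ⟨n + μs.sum, ?_⟩
    have hn' := congrArg Subtype.val hn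
    simp only [SetLike.val_smul, ZeroMemClass.coe_zero] at hn'
    rw [algebraMap_p_pow_smul p (n + μs.sum) x, pow_add, mul_smul]
    exact hn'
  have hcoker : ∀ y : E₂, ∃ (n : ℕ) (x : M),
      (p : ℤ_[p]) ^ n • y = ψ.restrictScalars ℤ_[p] x := by
    intro y
    obtain ⟨n, hn⟩ := exists_C_p_pow_smul_eq_zero_of_isPseudoNull p hcokerφ
      (Submodule.Quotient.mk (show elementaryModule p μs fs from ((0 : E₁), y)))
    rw [← Submodule.Quotient.mk_smul, Submodule.Quotient.mk_eq_zero, LinearMap.mem_range] at hn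
    obtain ⟨x, hx⟩ := hn
    refine ⟨n, x, ?_⟩
    have hx' : φ' x = (PowerSeries.C (p : ℤ_[p]) : IwasawaAlgebra p) ^ n • ((0 : E₁), y) := hx
    rw [LinearMap.restrictScalars_apply, LinearMap.comp_apply, hx', LinearMap.snd_apply,
      Prod.smul_snd]
    exact algebraMap_p_pow_smul p n y
  have hbij := Module.bijective_baseChange_of_pow_smul ℚ_[p] (isUnit_algebraMap_p p)
    (M := M) (N := E₂) (ψ.restrictScalars ℤ_[p]) hker hcoker
  haveI : Module.Finite ℚ_[p] (ℚ_[p] ⊗[ℤ_[p]] E₂) := Module.Finite.base_change ℤ_[p] ℚ_[p] E₂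
  exact Module.Finite.equiv (LinearEquiv.ofBijective _ hbij).symm

/-- **A `Λ`-module with `dim_{ℚ_p} ℚ_p ⊗_{ℤ_p} X < ∞` is `Λ`-torsion**, for any `Λ`-module
structure on the `ℤ_p`-module `X` in which the constants `C c` act as `c` (`IsScalarTower`):
for `x ∈ X` the `d + 1` vectors `1 ⊗ T^i x`, `i ≤ d = dim V`, are linearly dependent over `ℚ_p`;
clearing denominators (`IsLocalization.exist_integer_multiples_of_finset`) gives a non-zero
polynomial `g = ∑ a_i T^i ∈ ℤ_p[T] ⊆ Λ` with `1 ⊗ g x = 0`, i.e. `c g x = 0` for some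
`c ∈ ℤ_p ∖ 0` (`IsLocalizedModule.eq_zero_iff`), and `C(c) g ≠ 0`. (Washington §13.2, Lemma 13.7
ff.: a finitely generated `Λ`-module of finite `ℤ_p`-rank modulo `p`-power torsion is torsion.)
[folklore] -/
theorem isTorsion_of_finite_baseChange [Module.Finite ℚ_[p] (ℚ_[p] ⊗[ℤ_[p]] M)] :
    Module.IsTorsion (IwasawaAlgebra p) M := by
  classical
  intro x
  set d : ℕ := Module.finrank ℚ_[p] (ℚ_[p] ⊗[ℤ_[p]] M) with hd
  -- the vectors `1 ⊗ T^i x`, `i < d + 1`, are linearly dependent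
  set v : Fin (d + 1) → ℚ_[p] ⊗[ℤ_[p]] M := fun i ↦
    (1 : ℚ_[p]) ⊗ₜ[ℤ_[p]] ((PowerSeries.X : IwasawaAlgebra p) ^ (i : ℕ) • x) with hv
  have hdep : ¬ LinearIndependent ℚ_[p] v := fun hli ↦ by
    have h := hli.fintype_card_le_finrank
    rw [Fintype.card_fin, ← hd] at h
    exact Nat.not_succ_le_self d h
  rw [Fintype.not_linearIndependent_iff] at hdep
  obtain ⟨c, hc0, i₀, hi₀⟩ := hdep
  -- clear denominators: `b c_i = a_i ∈ ℤ_p`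
  obtain ⟨b, hb⟩ := IsLocalization.exist_integer_multiples_of_finset (nonZeroDivisors ℤ_[p])
    (Finset.univ.image c)
  have hb' : ∀ i, ∃ r : ℤ_[p], algebraMap ℤ_[p] ℚ_[p] r = (b : ℤ_[p]) • c i := fun i ↦
    RingHom.mem_rangeS.mp (hb (c i) (Finset.mem_image_of_mem c (Finset.mem_univ i)))
  choose a ha using hb'
  -- the polynomial `g = ∑ a_i T^i ≠ 0`
  set g : IwasawaAlgebra p :=
    ∑ i : Fin (d + 1), PowerSeries.C (a i) * PowerSeries.X ^ (i : ℕ) with hg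
  have hg0 : g ≠ 0 := by
    intro hzero
    have hcoeff : PowerSeries.coeff (i₀ : ℕ) g = a i₀ := by
      rw [hg, map_sum]
      simp only [PowerSeries.coeff_C_mul_X_pow]
      rw [Finset.sum_eq_single i₀ (fun j _ hj ↦ if_neg fun h ↦ hj (Fin.ext h).symm)
        (fun h ↦ absurd (Finset.mem_univ i₀) h), if_pos rfl]
    rw [hzero, map_zero] at hcoeff
    have h0 : (b : ℤ_[p]) • c i₀ = 0 := by rw [← ha i₀, ← hcoeff, map_zero]
    rcases smul_eq_zero.mp h0 with h | h
    · exact nonZeroDivisors.coe_ne_zero b h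
    · exact hi₀ h
  -- `1 ⊗ g x = b • ∑ c_i • v_i = 0` in `V`
  have h1 : g • x = ∑ i : Fin (d + 1), a i • ((PowerSeries.X : IwasawaAlgebra p) ^ (i : ℕ) • x) := by
    rw [hg, Finset.sum_smul]
    refine Finset.sum_congr rfl fun i _ ↦ ?_
    rw [mul_smul, ← PowerSeries.algebraMap_eq]
    exact algebraMap_smul (IwasawaAlgebra p) (a i) _
  have hgx : (1 : ℚ_[p]) ⊗ₜ[ℤ_[p]] (g • x) = 0 := by
    calc (1 : ℚ_[p]) ⊗ₜ[ℤ_[p]] (g • x)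
        = ∑ i : Fin (d + 1), (1 : ℚ_[p]) ⊗ₜ[ℤ_[p]]
            (a i • ((PowerSeries.X : IwasawaAlgebra p) ^ (i : ℕ) • x)) := by
          rw [h1, TensorProduct.tmul_sum]
      _ = ∑ i : Fin (d + 1), ((b : ℤ_[p]) • c i) • v i := Finset.sum_congr rfl fun i _ ↦ by
          rw [TensorProduct.tmul_smul, ← ha i, algebraMap_smul]
      _ = (b : ℤ_[p]) • ∑ i : Fin (d + 1), c i • v i := by
          rw [Finset.smul_sum]
          exact Finset.sum_congr rfl fun i _ ↦ smul_assoc _ _ _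
      _ = 0 := by rw [hc0, smul_zero]
  -- hence `s g x = 0` for some `s ∈ ℤ_p ∖ 0`, and `C(s) g ≠ 0` kills `x`
  obtain ⟨s, hs⟩ := (IsLocalizedModule.eq_zero_iff (nonZeroDivisors ℤ_[p])
    (TensorProduct.mk ℤ_[p] ℚ_[p] M 1)).mp hgx
  rw [Submonoid.smul_def, ← algebraMap_smul (IwasawaAlgebra p), PowerSeries.algebraMap_eq,
    smul_smul] at hs
  refine ⟨⟨PowerSeries.C (s : ℤ_[p]) * g, mem_nonZeroDivisors_of_ne_zero (mul_ne_zero ?_ hg0)⟩, hs⟩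
  rw [Ne, map_eq_zero_iff _ (PowerSeries.C_injective), ← Ne]
  exact nonZeroDivisors.coe_ne_zero s

end BaseChange

/-! ### Semisimplicity at `T` is necessary AND sufficient for `ord_T f = rank_{ℤ_p} X/TX` (appended)

Greenberg, LNM 1716, §1 (p. 65 of the held Cetraro volume), after Conjecture 1.12: with
`X ∼ ⊕ Λ/(f_i^{a_i})`, "`rank_{ℤ_p}(X/TX)` … would equal the power of `T` dividing `f_E(T)`,
assuming the above conjecture", i.e. assuming `a_i = 1` whenever `(f_i) = (T)`. The tree fact
`Greenberg1999_order_charGenerator_eq_coinvariantsRank` (discharged in `SelmerCorankControlProofs`)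
is this implication with the semisimplicity hypothesis spelled `ker T² = ker T` on
`V = ℚ_p ⊗_{ℤ_p} X`. The converse also holds — `ord_T f = rank_{ℤ_p} X/TX` FORCES `ker T² = ker T`
on `V` — and both directions are the computation `ord_T f = dim_{ℚ_p} ker(Tⁿ | V)` (`n ≫ 0`,
`order_charGenerator_eq_finrank_torsionBy` and flat base change) against
`rank_{ℤ_p} X/TX = dim coker(T | V) = dim ker(T | V)` (right exactness of `ℚ_p ⊗ -` and
rank–nullity on the finite-dimensional `V`): `dim ker Tⁿ = dim ker T` iff `ker Tⁿ = ker T` iff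
`ker T² = ker T`. In the arithmetic case `X = X(E/ℚ_∞)` this is the algebraic mechanism behind
Schneider's theorem: a degenerate `p`-adic height makes `T` non-semisimple on `V` and produces
EXTRA vanishing of `f_E` at `T = 0` beyond `corank Sel_{p^∞}(E/ℚ)` (Greenberg, §4 p. 110:
"if `h_p(P) = 0` … `T² | f_E(T)`"). -/

section Semisimple

variable {M : Type u} [AddCommGroup M] [Module (IwasawaAlgebra p) M]

/-- **`ord_T f = rank_{ℤ_p} X/TX ↔ ker T² = ker T` on `ℚ_p ⊗_{ℤ_p} X`**, for a finitely generated
torsion `Λ`-module `X` with `char(X) = (f)`. The direction `←` is the tree theorem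
`Greenberg1999_order_charGenerator_eq_coinvariantsRank_holds`; for `→`, with `V = ℚ_p ⊗ X`
(finite-dimensional, `finite_baseChange_of_isTorsion`) and `A = T ⊗ 1` (`mulTRat`):
`ord_T f = rank_{ℤ_p} X[Tⁿ] = dim ker Aⁿ` for `n ≥ 2` large (`order_charGenerator_eq_finrank_torsionBy`;
`ℚ_p` is flat over `ℤ_p`, so `ℚ_p ⊗ X[Tⁿ] = ker Aⁿ`), `rank_{ℤ_p} X/TX = dim (V / A V)` (right
exactness) `= dim ker A` (rank–nullity), so the hypothesis gives `dim ker Aⁿ = dim ker A`, whence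
`ker A ⊆ ker A² ⊆ ker Aⁿ = ker A`. Greenberg (1999), §1, Conj. 1.12 and the paragraph after it;
Washington §13.2 (Thm. 13.12). [cite: Greenberg1999, §1 p. 9 (after Conj. 1.12)]
[cite: Washington1997, §13.2 (Thm. 13.12, Prop. 13.8)] -/
theorem order_charGenerator_eq_coinvariantsRank_iff [Module.Finite (IwasawaAlgebra p) M]
    (hM : Module.IsTorsion (IwasawaAlgebra p) M) (f : IwasawaAlgebra p)
    (hf : Module.charIdeal (IwasawaAlgebra p) M = Ideal.span {f}) :
    f.order = (coinvariantsRank p M : ℕ∞) ↔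
      LinearMap.ker (mulTRat p M ∘ₗ mulTRat p M) = LinearMap.ker (mulTRat p M) := by
  refine ⟨fun hord ↦ ?_,
    fun hss ↦ Greenberg1999_order_charGenerator_eq_coinvariantsRank_holds p M hM f hf hss⟩
  -- the `ℤ_p`-structures of `X` and `X/TX` (definitionally those of `RestrictScalars ℤ_p Λ _`)
  letI : Module ℤ_[p] M := Module.compHom M (algebraMap ℤ_[p] (IwasawaAlgebra p))
  haveI : IsScalarTower ℤ_[p] (IwasawaAlgebra p) M := IsScalarTower.of_compHom ℤ_[p] _ _
  let Q : Submodule (IwasawaAlgebra p) M :=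
    Ideal.span {(PowerSeries.X : IwasawaAlgebra p)} • (⊤ : Submodule (IwasawaAlgebra p) M)
  letI : Module ℤ_[p] (M ⧸ Q) := Module.compHom (M ⧸ Q) (algebraMap ℤ_[p] (IwasawaAlgebra p))
  haveI : IsScalarTower ℤ_[p] (IwasawaAlgebra p) (M ⧸ Q) := IsScalarTower.of_compHom ℤ_[p] _ _
  haveI : Module.Flat ℤ_[p] ℚ_[p] := IsLocalization.flat ℚ_[p] (nonZeroDivisors ℤ_[p])
  haveI : Module.Finite ℚ_[p] (ℚ_[p] ⊗[ℤ_[p]] M) := finite_baseChange_of_isTorsion p hM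
  -- `dim_{ℚ_p} ℚ_p ⊗ N = rank_{ℤ_p} N`
  have hbc : ∀ (N : Type u) [AddCommGroup N] [Module ℤ_[p] N],
      Module.finrank ℚ_[p] (ℚ_[p] ⊗[ℤ_[p]] N) = Module.finrank ℤ_[p] N := fun N _ _ ↦ by
    rw [Module.finrank, Module.finrank, IsLocalization.rank_eq ℚ_[p] (nonZeroDivisors ℤ_[p]) le_rfl,
      IsLocalizedModule.rank_eq (nonZeroDivisors ℤ_[p]) le_rfl (TensorProduct.mk ℤ_[p] ℚ_[p] N 1)]
  -- `T^n` as a `ℤ_p`-linear map of `X`; `A = T ⊗ 1` is `mulTRat p M` (definitionally), `A^n = T^n ⊗ 1`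
  let L : ℕ → (M →ₗ[ℤ_[p]] M) := fun n ↦
    (DistribSMul.toLinearMap (IwasawaAlgebra p) M ((PowerSeries.X : IwasawaAlgebra p) ^ n)).restrictScalars ℤ_[p]
  let T₁ : M →ₗ[ℤ_[p]] M :=
    (DistribSMul.toLinearMap (IwasawaAlgebra p) M (PowerSeries.X : IwasawaAlgebra p)).restrictScalars ℤ_[p]
  have hLpow : ∀ n, T₁ ^ n = L n := fun n ↦ by
    induction n with
    | zero =>
      ext x
      change x = (PowerSeries.X : IwasawaAlgebra p) ^ 0 • x
      rw [pow_zero, one_smul]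
    | succ n ih =>
      ext x
      rw [pow_succ, Module.End.mul_apply, ih]
      change (PowerSeries.X : IwasawaAlgebra p) ^ n • (PowerSeries.X : IwasawaAlgebra p) • x =
        (PowerSeries.X : IwasawaAlgebra p) ^ (n + 1) • x
      rw [smul_smul, ← pow_succ]
  let A : (ℚ_[p] ⊗[ℤ_[p]] M) →ₗ[ℚ_[p]] (ℚ_[p] ⊗[ℤ_[p]] M) := T₁.baseChange ℚ_[p]
  have hAn : ∀ n, A ^ n = (L n).baseChange ℚ_[p] := fun n ↦ by
    change (T₁.baseChange ℚ_[p]) ^ n = _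
    rw [← LinearMap.baseChange_pow, hLpow]
  -- (1) `dim ker A^n = rank_{ℤ_p} X[T^n]` (flat base change of `0 → X[T^n] → X → X`)
  have hker : ∀ n, Module.finrank ℚ_[p] (LinearMap.ker (A ^ n)) =
      Module.finrank ℤ_[p] (Submodule.torsionBy (IwasawaAlgebra p) M
        ((PowerSeries.X : IwasawaAlgebra p) ^ n)) := fun n ↦ by
    have hex : Function.Exact ((LinearMap.ker (L n)).subtype.baseChange ℚ_[p])
        ((L n).baseChange ℚ_[p]) := by
      rw [LinearMap.baseChange_eq_ltensor, LinearMap.baseChange_eq_ltensor]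
      exact Module.Flat.lTensor_exact ℚ_[p] (LinearMap.exact_subtype_ker_map (L n))
    have hinj : Function.Injective ((LinearMap.ker (L n)).subtype.baseChange ℚ_[p]) := by
      rw [LinearMap.baseChange_eq_ltensor]
      exact Module.Flat.lTensor_preserves_injective_linearMap _ (Submodule.subtype_injective _)
    have hkerL : LinearMap.ker (L n) = (Submodule.torsionBy (IwasawaAlgebra p) M
        ((PowerSeries.X : IwasawaAlgebra p) ^ n)).restrictScalars ℤ_[p] := by
      ext x
      rw [LinearMap.mem_ker, Submodule.restrictScalars_mem, Submodule.mem_torsionBy_iff]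
      rfl
    rw [hAn n, LinearMap.exact_iff.mp hex, ← (LinearEquiv.ofInjective _ hinj).finrank_eq, hbc,
      (LinearEquiv.ofEq _ _ hkerL).finrank_eq]
    rfl
  -- (2) `rank_{ℤ_p} X/TX = dim (V / A V)` (right exactness of `ℚ_p ⊗ -` on `X → X → X/TX → 0`)
  let π : M →ₗ[ℤ_[p]] M ⧸ Q := Q.mkQ.restrictScalars ℤ_[p]
  have hπ : Function.Surjective π := Submodule.mkQ_surjective Q
  have hexT : Function.Exact T₁ π := by
    intro y
    change Q.mkQ y = 0 ↔ y ∈ Set.range T₁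
    rw [Submodule.mkQ_apply, Submodule.Quotient.mk_eq_zero, Set.mem_range]
    change y ∈ Ideal.span {(PowerSeries.X : IwasawaAlgebra p)} • (⊤ : Submodule (IwasawaAlgebra p) M) ↔ _
    rw [Submodule.ideal_span_singleton_smul, Submodule.mem_smul_pointwise_iff_exists]
    constructor
    · rintro ⟨x, -, rfl⟩
      exact ⟨x, rfl⟩
    · rintro ⟨x, rfl⟩
      exact ⟨x, Submodule.mem_top, rfl⟩
  have hexT' : Function.Exact A (π.baseChange ℚ_[p]) := by
    change Function.Exact (T₁.baseChange ℚ_[p]) (π.baseChange ℚ_[p])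
    rw [LinearMap.baseChange_eq_ltensor, LinearMap.baseChange_eq_ltensor]
    exact lTensor_exact ℚ_[p] hexT hπ
  have hsurj : Function.Surjective (π.baseChange ℚ_[p]) := by
    rw [LinearMap.baseChange_eq_ltensor]
    exact LinearMap.lTensor_surjective ℚ_[p] hπ
  have hcoker : Module.finrank ℚ_[p] ((ℚ_[p] ⊗[ℤ_[p]] M) ⧸ LinearMap.range A) =
      coinvariantsRank p M := by
    rw [(hexT'.linearEquivOfSurjective hsurj).finrank_eq, coinvariantsRank_eq_finrank]
    rfl
  -- (3) rank–nullity on the finite-dimensional `V`: `dim (V / A V) = dim ker A`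
  have hrn := LinearMap.finrank_range_add_finrank_ker A
  have hq := Submodule.finrank_quotient_add_finrank (LinearMap.range A)
  have hcoinv : coinvariantsRank p M = Module.finrank ℚ_[p] (LinearMap.ker A) := by omega
  -- (4) the hypothesis: `dim ker A^n = ord_T f = rank X/TX = dim ker A` for `n ≥ 2` large
  obtain ⟨n₀, hn₀⟩ := exists_order_charGenerator_eq_finrank_torsionBy p hM f hf
  obtain ⟨k, hk⟩ : ∃ k : ℕ, max n₀ 2 = k + 2 := ⟨max n₀ 2 - 2, by omega⟩
  have hdim : Module.finrank ℚ_[p] (LinearMap.ker A) =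
      Module.finrank ℚ_[p] (LinearMap.ker (A ^ (k + 2))) := by
    have e1 := (hn₀ (max n₀ 2) (le_max_left _ _)).symm.trans hord
    rw [hk, Nat.cast_inj] at e1
    rw [hker, e1, hcoinv]
  -- (5) `ker A ⊆ ker A² ⊆ ker A^n = ker A`
  have h2 : LinearMap.ker (A ∘ₗ A) ≤ LinearMap.ker (A ^ (k + 2)) := by
    rw [pow_add, pow_two, Module.End.mul_eq_comp, Module.End.mul_eq_comp]
    exact LinearMap.ker_le_ker_comp _ _
  have h1 : LinearMap.ker A ≤ LinearMap.ker (A ∘ₗ A) := LinearMap.ker_le_ker_comp _ _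
  have heq : LinearMap.ker A = LinearMap.ker (A ^ (k + 2)) :=
    Submodule.eq_of_le_of_finrank_eq (h1.trans h2) hdim
  -- `mulTRat p M` is `A` (definitionally: the `ℤ_p`-structure of `X` is that of `RestrictScalars`)
  change LinearMap.ker (A ∘ₗ A) = LinearMap.ker A
  exact le_antisymm (heq ▸ h2) h1

end Semisimple

end IwasawaAlgebra

end Literature.NumberTheory.EllipticCurves
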